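import Summits.Ventures.PercRepro.PurePairGraphBot
import Summits.Ventures.PercRepro.C026HGraph

/-!
# The pure-pair gadget — centrals, branches and the edges between given vertices (module 3a)

The centrals `cen i`, the branch labelling `br`, the kinds of edges (`edge_cases`) and the six
`exists_joins_*` lemmas enumerating the edges between a central and a hub / pair vertex, between the
two vertices of a pair, and between two centrals.
-/

namespace PercRepro.PurePairGraph

open MultiGraph StarGadgetGraph

variable {p q r s n : ℕ}

/-- The central `i` (`a b c x = 0 1 2 3`) as a vertex. -/
def cen (i : Fin 4) : PV p q r s n := Sum.inl i

/-- `cen` of a `castSucc` is the mark. -/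
theorem cen_castSucc (m : Fin 3) : (cen m.castSucc : PV p q r s n) = vm m := rfl

/-- `cen 3` is the centre. -/
theorem cen_last : (cen 3 : PV p q r s n) = vx := rfl

/-- A central is a mark or the centre. -/
theorem cen_cases (i : Fin 4) : (∃ m : Fin 3, i = m.castSucc) ∨ i = 3 :=
  Fin.eq_castSucc_or_eq_last i

/-- The centrals are `Cen`. -/
theorem cen_mem_cen (i : Fin 4) : cen i ∈ Cen p q r s n := ⟨i, rfl⟩

/-- `Cen` is the range of `cen`. -/
theorem cen_eq_range : Cen p q r s n = Set.range (cen : Fin 4 → PV p q r s n) := rfl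

/-- `cen` is injective. -/
theorem cen_injective : Function.Injective (cen : Fin 4 → PV p q r s n) := Sum.inl_injective

/-- A central is not a hub vertex. -/
theorem cen_ne_hv (i : Fin 4) (h : Hub p q r s) : (cen i : PV p q r s n) ≠ hv h := Sum.inl_ne_inr

/-- A central is not a pair vertex. -/
theorem cen_ne_pv (i : Fin 4) (j : Fin n) (w : Bool) : (cen i : PV p q r s n) ≠ pv j w :=
  Sum.inl_ne_inr

/-- A vertex is a central, a hub vertex or a pair vertex. -/
theorem vertex_cases (v : PV p q r s n) :
    (∃ i, v = cen i) ∨ (∃ h, v = hv h) ∨ ∃ j w, v = pv j w := by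
  rcases v with i | ⟨b, x⟩
  · exact Or.inl ⟨i, rfl⟩
  · rcases b with h | j
    · exact Or.inr (Or.inl ⟨h, rfl⟩)
    · exact Or.inr (Or.inr ⟨j, x, rfl⟩)

/-- The branch of a hub vertex. -/
theorem br_hv (h : Hub p q r s) : br (hv h : PV p q r s n) = some (Sum.inl h) := rfl

/-- The branch of a pair vertex. -/
theorem br_pv (j : Fin n) (w : Bool) : br (pv j w : PV p q r s n) = some (Sum.inr j) := rfl

/-- The branch of a central. -/
theorem br_cen (i : Fin 4) : br (cen i : PV p q r s n) = none := rfl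

/-- `xOpen` is the state predicate `xo`. -/
theorem xOpen_iff (ω : Config (PE p q r s n)) (h : Hub p q r s) :
    xOpen ω h ↔ xo (hubState ω h) := Iff.rfl

/-- `markOpen` is the state predicate `mo`. -/
theorem markOpen_iff (ω : Config (PE p q r s n)) (h : Hub p q r s) (m : Fin 3) :
    markOpen ω h m ↔ mo (hubState ω h) m := Iff.rfl

/-! ### Edges -/

/-- The endpoints of every edge, by kind. -/
theorem edge_cases (e : PE p q r s n) :
    (e = .inl 0 ∧ (purePairGadget p q r s n).fst e = vm 2 ∧ (purePairGadget p q r s n).snd e = vx) ∨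
    (∃ h, e = .inr ⟨.inl h, none⟩ ∧ (purePairGadget p q r s n).fst e = vx ∧
      (purePairGadget p q r s n).snd e = hv h) ∨
    (∃ h i, e = .inr ⟨.inl h, some i⟩ ∧
      (purePairGadget p q r s n).fst e = vm ((hubType h).marks.get i) ∧
      (purePairGadget p q r s n).snd e = hv h) ∨
    (∃ j, e = .inr ⟨.inr j, (0 : Fin 5)⟩ ∧ (purePairGadget p q r s n).fst e = pv j false ∧
      (purePairGadget p q r s n).snd e = pv j true) ∨
    (∃ j w, e = .inr ⟨.inr j, (if w then 2 else 1 : Fin 5)⟩ ∧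
      (purePairGadget p q r s n).fst e = vx ∧ (purePairGadget p q r s n).snd e = pv j w) ∨
    (∃ j w, e = .inr ⟨.inr j, (if w then 4 else 3 : Fin 5)⟩ ∧
      (purePairGadget p q r s n).fst e = vm 2 ∧ (purePairGadget p q r s n).snd e = pv j w) := by
  rcases e with k | ⟨b, j⟩
  · exact Or.inl ⟨congrArg Sum.inl (Subsingleton.elim k 0), rfl, rfl⟩
  · rcases b with h | j'
    · rcases j with _ | i
      · exact Or.inr (Or.inl ⟨h, rfl, rfl, rfl⟩)
      · exact Or.inr (Or.inr (Or.inl ⟨h, i, rfl, rfl, rfl⟩))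
    · fin_cases j
      · exact Or.inr (Or.inr (Or.inr (Or.inl ⟨j', rfl, rfl, rfl⟩)))
      · exact Or.inr (Or.inr (Or.inr (Or.inr (Or.inl ⟨j', false, rfl, rfl, rfl⟩))))
      · exact Or.inr (Or.inr (Or.inr (Or.inr (Or.inl ⟨j', true, rfl, rfl, rfl⟩))))
      · exact Or.inr (Or.inr (Or.inr (Or.inr (Or.inr ⟨j', false, rfl, rfl, rfl⟩))))
      · exact Or.inr (Or.inr (Or.inr (Or.inr (Or.inr ⟨j', true, rfl, rfl, rfl⟩))))

/-! ### The edges between given vertices -/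

/-- The edges joining a mark to a hub are the hub's edges to that mark. -/
theorem exists_joins_vm_hv_iff (Q : PE p q r s n → Prop) (m : Fin 3) (h : Hub p q r s) :
    (∃ e, Q e ∧ (purePairGadget p q r s n).Joins e (vm m) (hv h)) ↔
      ∃ i, (hubType h).marks.get i = m ∧ Q (.inr ⟨.inl h, some i⟩) := by
  constructor
  · rintro ⟨e, hQ, hj⟩
    rcases edge_cases e with ⟨rfl, h1, h2⟩ | ⟨h', rfl, h1, h2⟩ | ⟨h', k, rfl, h1, h2⟩ |
      ⟨j', rfl, h1, h2⟩ | ⟨j', w', rfl, h1, h2⟩ | ⟨j', w', rfl, h1, h2⟩ <;>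
      rcases hj with ⟨ha, hb⟩ | ⟨ha, hb⟩ <;> rw [h1] at ha <;> rw [h2] at hb <;>
      first
      | exact absurd ha (vm_ne_vx _) | exact absurd ha (vm_ne_vx _).symm
      | exact absurd ha (vm_ne_hv _ _) | exact absurd ha (vm_ne_hv _ _).symm
      | exact absurd ha (vm_ne_pv _ _ _) | exact absurd ha (vm_ne_pv _ _ _).symm
      | exact absurd ha (vx_ne_hv _) | exact absurd ha (vx_ne_hv _).symm
      | exact absurd ha (vx_ne_pv _ _) | exact absurd ha (vx_ne_pv _ _).symm
      | exact absurd ha (hv_ne_pv _ _ _) | exact absurd ha (hv_ne_pv _ _ _).symm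
      | exact absurd ha (cen_ne_hv _ _) | exact absurd ha (cen_ne_hv _ _).symm
      | exact absurd ha (cen_ne_pv _ _ _) | exact absurd ha (cen_ne_pv _ _ _).symm
      | exact absurd hb (vm_ne_vx _) | exact absurd hb (vm_ne_vx _).symm
      | exact absurd hb (vm_ne_hv _ _) | exact absurd hb (vm_ne_hv _ _).symm
      | exact absurd hb (vm_ne_pv _ _ _) | exact absurd hb (vm_ne_pv _ _ _).symm
      | exact absurd hb (vx_ne_hv _) | exact absurd hb (vx_ne_hv _).symm
      | exact absurd hb (vx_ne_pv _ _) | exact absurd hb (vx_ne_pv _ _).symm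
      | exact absurd hb (hv_ne_pv _ _ _) | exact absurd hb (hv_ne_pv _ _ _).symm
      | exact absurd hb (cen_ne_hv _ _) | exact absurd hb (cen_ne_hv _ _).symm
      | exact absurd hb (cen_ne_pv _ _ _) | exact absurd hb (cen_ne_pv _ _ _).symm
      | (obtain rfl := hv_inj.1 hb; exact ⟨k, vm_inj.1 ha, hQ⟩)
  · rintro ⟨i, hi, hQ⟩
    refine ⟨.inr ⟨.inl h, some i⟩, hQ, Or.inl ⟨?_, rfl⟩⟩
    show vm ((hubType h).marks.get i) = vm m
    rw [hi]

/-- The edges joining the centre to a hub: its `x`-edge. -/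
theorem exists_joins_vx_hv_iff (Q : PE p q r s n → Prop) (h : Hub p q r s) :
    (∃ e, Q e ∧ (purePairGadget p q r s n).Joins e vx (hv h)) ↔ Q (.inr ⟨.inl h, none⟩) := by
  constructor
  · rintro ⟨e, hQ, hj⟩
    rcases edge_cases e with ⟨rfl, h1, h2⟩ | ⟨h', rfl, h1, h2⟩ | ⟨h', k, rfl, h1, h2⟩ |
      ⟨j', rfl, h1, h2⟩ | ⟨j', w', rfl, h1, h2⟩ | ⟨j', w', rfl, h1, h2⟩ <;>
      rcases hj with ⟨ha, hb⟩ | ⟨ha, hb⟩ <;> rw [h1] at ha <;> rw [h2] at hb <;>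
      first
      | exact absurd ha (vm_ne_vx _) | exact absurd ha (vm_ne_vx _).symm
      | exact absurd ha (vm_ne_hv _ _) | exact absurd ha (vm_ne_hv _ _).symm
      | exact absurd ha (vm_ne_pv _ _ _) | exact absurd ha (vm_ne_pv _ _ _).symm
      | exact absurd ha (vx_ne_hv _) | exact absurd ha (vx_ne_hv _).symm
      | exact absurd ha (vx_ne_pv _ _) | exact absurd ha (vx_ne_pv _ _).symm
      | exact absurd ha (hv_ne_pv _ _ _) | exact absurd ha (hv_ne_pv _ _ _).symm
      | exact absurd ha (cen_ne_hv _ _) | exact absurd ha (cen_ne_hv _ _).symm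
      | exact absurd ha (cen_ne_pv _ _ _) | exact absurd ha (cen_ne_pv _ _ _).symm
      | exact absurd hb (vm_ne_vx _) | exact absurd hb (vm_ne_vx _).symm
      | exact absurd hb (vm_ne_hv _ _) | exact absurd hb (vm_ne_hv _ _).symm
      | exact absurd hb (vm_ne_pv _ _ _) | exact absurd hb (vm_ne_pv _ _ _).symm
      | exact absurd hb (vx_ne_hv _) | exact absurd hb (vx_ne_hv _).symm
      | exact absurd hb (vx_ne_pv _ _) | exact absurd hb (vx_ne_pv _ _).symm
      | exact absurd hb (hv_ne_pv _ _ _) | exact absurd hb (hv_ne_pv _ _ _).symm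
      | exact absurd hb (cen_ne_hv _ _) | exact absurd hb (cen_ne_hv _ _).symm
      | exact absurd hb (cen_ne_pv _ _ _) | exact absurd hb (cen_ne_pv _ _ _).symm
      | (obtain rfl := hv_inj.1 hb; exact hQ)
  · intro hQ
    exact ⟨.inr ⟨.inl h, none⟩, hQ, Or.inl ⟨rfl, rfl⟩⟩

/-- The edges joining a mark to a pair vertex: for `c` its c-edge; none for `a`, `b`. -/
theorem exists_joins_vm_pv_iff (Q : PE p q r s n → Prop) (m : Fin 3) (j : Fin n) (w : Bool) :
    (∃ e, Q e ∧ (purePairGadget p q r s n).Joins e (vm m) (pv j w)) ↔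
      m = 2 ∧ Q (.inr ⟨.inr j, (if w then 4 else 3 : Fin 5)⟩) := by
  constructor
  · rintro ⟨e, hQ, hj⟩
    rcases edge_cases e with ⟨rfl, h1, h2⟩ | ⟨h', rfl, h1, h2⟩ | ⟨h', k, rfl, h1, h2⟩ |
      ⟨j', rfl, h1, h2⟩ | ⟨j', w', rfl, h1, h2⟩ | ⟨j', w', rfl, h1, h2⟩ <;>
      rcases hj with ⟨ha, hb⟩ | ⟨ha, hb⟩ <;> rw [h1] at ha <;> rw [h2] at hb <;>
      first
      | exact absurd ha (vm_ne_vx _) | exact absurd ha (vm_ne_vx _).symm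
      | exact absurd ha (vm_ne_hv _ _) | exact absurd ha (vm_ne_hv _ _).symm
      | exact absurd ha (vm_ne_pv _ _ _) | exact absurd ha (vm_ne_pv _ _ _).symm
      | exact absurd ha (vx_ne_hv _) | exact absurd ha (vx_ne_hv _).symm
      | exact absurd ha (vx_ne_pv _ _) | exact absurd ha (vx_ne_pv _ _).symm
      | exact absurd ha (hv_ne_pv _ _ _) | exact absurd ha (hv_ne_pv _ _ _).symm
      | exact absurd ha (cen_ne_hv _ _) | exact absurd ha (cen_ne_hv _ _).symm
      | exact absurd ha (cen_ne_pv _ _ _) | exact absurd ha (cen_ne_pv _ _ _).symm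
      | exact absurd hb (vm_ne_vx _) | exact absurd hb (vm_ne_vx _).symm
      | exact absurd hb (vm_ne_hv _ _) | exact absurd hb (vm_ne_hv _ _).symm
      | exact absurd hb (vm_ne_pv _ _ _) | exact absurd hb (vm_ne_pv _ _ _).symm
      | exact absurd hb (vx_ne_hv _) | exact absurd hb (vx_ne_hv _).symm
      | exact absurd hb (vx_ne_pv _ _) | exact absurd hb (vx_ne_pv _ _).symm
      | exact absurd hb (hv_ne_pv _ _ _) | exact absurd hb (hv_ne_pv _ _ _).symm
      | exact absurd hb (cen_ne_hv _ _) | exact absurd hb (cen_ne_hv _ _).symm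
      | exact absurd hb (cen_ne_pv _ _ _) | exact absurd hb (cen_ne_pv _ _ _).symm
      | (obtain ⟨rfl, rfl⟩ := pv_inj.1 hb; exact ⟨(vm_inj.1 ha).symm, hQ⟩)
  · rintro ⟨rfl, hQ⟩
    refine ⟨.inr ⟨.inr j, (if w then 4 else 3 : Fin 5)⟩, hQ, Or.inl ⟨?_, ?_⟩⟩ <;> cases w <;> rfl

/-- The edges joining the centre to a pair vertex: its x-edge. -/
theorem exists_joins_vx_pv_iff (Q : PE p q r s n → Prop) (j : Fin n) (w : Bool) :
    (∃ e, Q e ∧ (purePairGadget p q r s n).Joins e vx (pv j w)) ↔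
      Q (.inr ⟨.inr j, (if w then 2 else 1 : Fin 5)⟩) := by
  constructor
  · rintro ⟨e, hQ, hj⟩
    rcases edge_cases e with ⟨rfl, h1, h2⟩ | ⟨h', rfl, h1, h2⟩ | ⟨h', k, rfl, h1, h2⟩ |
      ⟨j', rfl, h1, h2⟩ | ⟨j', w', rfl, h1, h2⟩ | ⟨j', w', rfl, h1, h2⟩ <;>
      rcases hj with ⟨ha, hb⟩ | ⟨ha, hb⟩ <;> rw [h1] at ha <;> rw [h2] at hb <;>
      first
      | exact absurd ha (vm_ne_vx _) | exact absurd ha (vm_ne_vx _).symm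
      | exact absurd ha (vm_ne_hv _ _) | exact absurd ha (vm_ne_hv _ _).symm
      | exact absurd ha (vm_ne_pv _ _ _) | exact absurd ha (vm_ne_pv _ _ _).symm
      | exact absurd ha (vx_ne_hv _) | exact absurd ha (vx_ne_hv _).symm
      | exact absurd ha (vx_ne_pv _ _) | exact absurd ha (vx_ne_pv _ _).symm
      | exact absurd ha (hv_ne_pv _ _ _) | exact absurd ha (hv_ne_pv _ _ _).symm
      | exact absurd ha (cen_ne_hv _ _) | exact absurd ha (cen_ne_hv _ _).symm
      | exact absurd ha (cen_ne_pv _ _ _) | exact absurd ha (cen_ne_pv _ _ _).symm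
      | exact absurd hb (vm_ne_vx _) | exact absurd hb (vm_ne_vx _).symm
      | exact absurd hb (vm_ne_hv _ _) | exact absurd hb (vm_ne_hv _ _).symm
      | exact absurd hb (vm_ne_pv _ _ _) | exact absurd hb (vm_ne_pv _ _ _).symm
      | exact absurd hb (vx_ne_hv _) | exact absurd hb (vx_ne_hv _).symm
      | exact absurd hb (vx_ne_pv _ _) | exact absurd hb (vx_ne_pv _ _).symm
      | exact absurd hb (hv_ne_pv _ _ _) | exact absurd hb (hv_ne_pv _ _ _).symm
      | exact absurd hb (cen_ne_hv _ _) | exact absurd hb (cen_ne_hv _ _).symm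
      | exact absurd hb (cen_ne_pv _ _ _) | exact absurd hb (cen_ne_pv _ _ _).symm
      | (obtain ⟨rfl, rfl⟩ := pv_inj.1 hb; exact hQ)
  · intro hQ
    refine ⟨.inr ⟨.inr j, (if w then 2 else 1 : Fin 5)⟩, hQ, Or.inl ⟨?_, ?_⟩⟩ <;> cases w <;> rfl

/-- The edges joining the two vertices of a pair: `u – v`. -/
theorem exists_joins_pv_pv_iff (Q : PE p q r s n → Prop) (j : Fin n) :
    (∃ e, Q e ∧ (purePairGadget p q r s n).Joins e (pv j false) (pv j true)) ↔
      Q (.inr ⟨.inr j, (0 : Fin 5)⟩) := by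
  constructor
  · rintro ⟨e, hQ, hj⟩
    rcases edge_cases e with ⟨rfl, h1, h2⟩ | ⟨h', rfl, h1, h2⟩ | ⟨h', k, rfl, h1, h2⟩ |
      ⟨j', rfl, h1, h2⟩ | ⟨j', w', rfl, h1, h2⟩ | ⟨j', w', rfl, h1, h2⟩ <;>
      rcases hj with ⟨ha, hb⟩ | ⟨ha, hb⟩ <;> rw [h1] at ha <;> rw [h2] at hb <;>
      first
      | exact absurd ha (vm_ne_vx _) | exact absurd ha (vm_ne_vx _).symm
      | exact absurd ha (vm_ne_hv _ _) | exact absurd ha (vm_ne_hv _ _).symm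
      | exact absurd ha (vm_ne_pv _ _ _) | exact absurd ha (vm_ne_pv _ _ _).symm
      | exact absurd ha (vx_ne_hv _) | exact absurd ha (vx_ne_hv _).symm
      | exact absurd ha (vx_ne_pv _ _) | exact absurd ha (vx_ne_pv _ _).symm
      | exact absurd ha (hv_ne_pv _ _ _) | exact absurd ha (hv_ne_pv _ _ _).symm
      | exact absurd ha (cen_ne_hv _ _) | exact absurd ha (cen_ne_hv _ _).symm
      | exact absurd ha (cen_ne_pv _ _ _) | exact absurd ha (cen_ne_pv _ _ _).symm
      | exact absurd hb (vm_ne_vx _) | exact absurd hb (vm_ne_vx _).symm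
      | exact absurd hb (vm_ne_hv _ _) | exact absurd hb (vm_ne_hv _ _).symm
      | exact absurd hb (vm_ne_pv _ _ _) | exact absurd hb (vm_ne_pv _ _ _).symm
      | exact absurd hb (vx_ne_hv _) | exact absurd hb (vx_ne_hv _).symm
      | exact absurd hb (vx_ne_pv _ _) | exact absurd hb (vx_ne_pv _ _).symm
      | exact absurd hb (hv_ne_pv _ _ _) | exact absurd hb (hv_ne_pv _ _ _).symm
      | exact absurd hb (cen_ne_hv _ _) | exact absurd hb (cen_ne_hv _ _).symm
      | exact absurd hb (cen_ne_pv _ _ _) | exact absurd hb (cen_ne_pv _ _ _).symm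
      | (obtain ⟨rfl, -⟩ := pv_inj.1 ha; exact hQ)
  · intro hQ
    exact ⟨.inr ⟨.inr j, (0 : Fin 5)⟩, hQ, Or.inl ⟨rfl, rfl⟩⟩

/-- The edges joining two distinct centrals: the edge `c – x`. -/
theorem exists_joins_cen_cen_iff (Q : PE p q r s n → Prop) (i j : Fin 4) :
    (∃ e, Q e ∧ (purePairGadget p q r s n).Joins e (cen i) (cen j)) ↔
      ((i = 2 ∧ j = 3) ∨ (i = 3 ∧ j = 2)) ∧ Q (.inl 0) := by
  constructor
  · rintro ⟨e, hQ, hj⟩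
    rcases edge_cases e with ⟨rfl, h1, h2⟩ | ⟨h', rfl, h1, h2⟩ | ⟨h', k, rfl, h1, h2⟩ |
      ⟨j', rfl, h1, h2⟩ | ⟨j', w', rfl, h1, h2⟩ | ⟨j', w', rfl, h1, h2⟩ <;>
      rcases hj with ⟨ha, hb⟩ | ⟨ha, hb⟩ <;> rw [h1] at ha <;> rw [h2] at hb <;>
      first
      | exact absurd ha (vm_ne_vx _) | exact absurd ha (vm_ne_vx _).symm
      | exact absurd ha (vm_ne_hv _ _) | exact absurd ha (vm_ne_hv _ _).symm
      | exact absurd ha (vm_ne_pv _ _ _) | exact absurd ha (vm_ne_pv _ _ _).symm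
      | exact absurd ha (vx_ne_hv _) | exact absurd ha (vx_ne_hv _).symm
      | exact absurd ha (vx_ne_pv _ _) | exact absurd ha (vx_ne_pv _ _).symm
      | exact absurd ha (hv_ne_pv _ _ _) | exact absurd ha (hv_ne_pv _ _ _).symm
      | exact absurd ha (cen_ne_hv _ _) | exact absurd ha (cen_ne_hv _ _).symm
      | exact absurd ha (cen_ne_pv _ _ _) | exact absurd ha (cen_ne_pv _ _ _).symm
      | exact absurd hb (vm_ne_vx _) | exact absurd hb (vm_ne_vx _).symm
      | exact absurd hb (vm_ne_hv _ _) | exact absurd hb (vm_ne_hv _ _).symm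
      | exact absurd hb (vm_ne_pv _ _ _) | exact absurd hb (vm_ne_pv _ _ _).symm
      | exact absurd hb (vx_ne_hv _) | exact absurd hb (vx_ne_hv _).symm
      | exact absurd hb (vx_ne_pv _ _) | exact absurd hb (vx_ne_pv _ _).symm
      | exact absurd hb (hv_ne_pv _ _ _) | exact absurd hb (hv_ne_pv _ _ _).symm
      | exact absurd hb (cen_ne_hv _ _) | exact absurd hb (cen_ne_hv _ _).symm
      | exact absurd hb (cen_ne_pv _ _ _) | exact absurd hb (cen_ne_pv _ _ _).symm
      | exact ⟨Or.inl ⟨(cen_injective ha).symm, (cen_injective hb).symm⟩, hQ⟩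
      | exact ⟨Or.inr ⟨(cen_injective hb).symm, (cen_injective ha).symm⟩, hQ⟩
  · rintro ⟨hij, hQ⟩
    refine ⟨.inl 0, hQ, ?_⟩
    rcases hij with ⟨rfl, rfl⟩ | ⟨rfl, rfl⟩
    · exact Or.inl ⟨rfl, rfl⟩
    · exact Or.inr ⟨rfl, rfl⟩

/-! ### The H-adjacency tables: centrals and hubs -/

/-- The edge `c – x` is closed iff `¬ cxOpen`. -/
theorem cx_closed_iff (ω : Config (PE p q r s n)) : ω (.inl 0) = false ↔ ¬ cxOpen ω := by
  unfold cxOpen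
  cases ω (.inl 0) <;> simp

end PercRepro.PurePairGraph
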